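import Summits.QuantumFields.YangMills.Theorems.UnitScaleTiltFluctuationComparisonRegPrGlobalSlackKernelLegDisplay
import Summits.QuantumFields.YangMills.Theorems.UnitScaleTiltFluctuationComparisonRegPrGlobalSlackKernelLegResidualFarProfile
import Summits.QuantumFields.YangMills.Theorems.UnitScaleTiltFluctuationComparisonRegPrGlobalSlackCanonicalPolymersCoreSizesProfile
import Summits.QuantumFields.YangMills.Theorems.UnitScaleTiltFluctuationComparisonRegPrGlobalSlackHigherProfile
import Summits.QuantumFields.YangMills.Theorems.UnitScaleTiltFluctuationComparisonRegPrIntLOneSupplier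
import HarnessLib

/-!
# `UnitScaleTiltFluctuationComparisonRegPrGlobalSlackKernelLegDisplayProfile` — 3⁗χ'S PER-RUN DISPLAY OBLIGATION AT A SUPPLIER-CHOSEN LOG-PROFILE `p₁ ≥ p₀ + r₀`: SIX ROWS
# ((F^Λ) GONE), AND KING'S SLACK ROW AT `p₁` FROM THEM (crux `FluctuationComparisonRegPrIntL`, stmt-QuantumFields-20520, skeleton v5kC, STUB 3⁗χ `stub_globalTwoRunSlackFamChi`;
# width seat ym-ust-20520-w1 g2, successor of w1 g0; count-neutral; YM₃ on the 3-torus is ladder rung R3, not the Clay problem)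

WHY.  ★w1 g0's display obligation `K1aLegRowsDisplayChi L 𝔠 a₀ a₁ a` (p586902) lists SEVEN per-run rows at the record's profile `(𝔠.b₀, 𝔠.p₀)` and gives the REGISTERED text of
3⁗χ (`GlobalSupRateTSlack … 𝔠.b₀ 𝔠.p₀ a σ C`).  ★ym-ust-19935-r1 g5's higher-profile door (`…GlobalSlackHigherProfile`: `GlobalSlackOn.regPrIntL_of_recChi_slackOnChi_higherProfile_allL`)
lets the DECIDING crux read the slack row at ANY `p₁ ≥ 𝔠.p₀` instead.  At `p₁ ≥ 𝔠.p₀ + 𝔠.r₀` one of the seven rows, (F^Λ) `LambdaFarSmallOwn`, is a THEOREM of the displayed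
G3D-07 row (`…KernelLegResidualFarProfile.lambdaFarSmallOwn_of_record`, this seat), so the display obligation in the door's currency has SIX rows:

* §1 **`K1aLegRowsDisplayChiAt L 𝔠 a₀ a₁ a p₁`** (hypothesis schema, never asserted): (R1) `KernelRefOwnΦ`, (R2′) leg-weighted analyticity `ChartAnalyticΦ … (rescaleΦw (canonLegDist F) κ′ Φ)`,
  (N) `NewLevelIsBirth`, (M1) `OldTermsAreJetsOwn` — profile-free, VERBATIM as in `K1aLegRowsDisplayChi` — and the two configuration rows (R4) `CfgDistOwnΦ … 𝔠.b₀ p₁ C_s`,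
  (R5) `CfgRefOwnΦ … 𝔠.b₀ p₁ a C_B` at the profile `p₁`; reference objects `Ψ` (height-free), `BR` (coherent) BEFORE the (α) hypothesis, as before;
* §2 **`globalSupRateTSlack_of_k1aLegRowsDisplayChiAt`**: for `0 < a < 1` and `𝔠.p₀ + 𝔠.r₀ ≤ p₁`, the six rows give a coupling threshold and, for every family / coupling /
  inhabited χ-package, a coherent `p`, the canonical polymerisation and `σ ≥ 7`, `C ≥ 0` with `GlobalSupRateTSlack (dataOfV3chi p π) 𝔠.b₀ p₁ a σ C` — ★w1 g0's chain
  (`kernelLegΦ_of_chartAnalyticLeg`, `kernelRefΦ_of_own`/`flatKernelLegCauchyΦ_of_ref`, `remainderSmallΦ_of_own`, `cfgDistΦ_of_own`, `cfgRefΦ_of_own`/`cfgDistCauchyΦ_of_ref`,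
  the `rescaleW` transfers) and lane A's `globalTwoRunSlackTail_of_chartsC`, all profile-generic underneath, fed with THIS SEAT's (R3)-at-`p₁` theorem
  `remainderSmallOwnΦ_chi_of_jets_profile` and producer row 5 at `p₁` `termSizeTrivT_canonCore_profile`; threshold
  `γB ⊓ gammaW L 𝔠 C_s′ C_B′ ⊓ gammaθ 𝔠.b₀ p₁ (1/max 1 (C_s′+C_B′)) ⊓ e^{2(1−p₁)}` (`C_s′ = C_s(1+κ′⁻¹)`, `C_B′ = 2C_B(1+κ′⁻¹)`).
* §3 **`regPrIntL_of_T8_recChi_k1aLegRowsDisplayChiAt_allL`** / **`regPrIntL_of_v8Leaves_recChi_k1aLegRowsDisplayChiAt_allL`**: the DECIDING crux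
  `FluctuationComparisonRegPrIntL` from T8's text (resp. 19200 v8's five registered leaves, via ★r1 g5's `thm1In8GlobalMin_of_v8Leaves`), 2′χ, and — for every odd `L > 1`, every
  record and [7]-constants — a rate `a ∈ (0,1)`, a profile `p₁ ≥ 𝔠.p₀ + 𝔠.r₀` and the SIX-row display `K1aLegRowsDisplayChiAt L 𝔠 a₀ a₁ a p₁`; STUB 1 by
  `ApproxLift.AnsatzT.stub_oneStepSmallLift`; the door `regPrIntL_of_recChi_slackOnChi_higherProfile_allL` entered through `GlobalSlackOn.on_of_global` (full window ⟹ On-χ).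
  Compare ★r1 g5's `regPrIntL_of_v8Leaves_recChi_k1aLegRowsDisplayChi_allL` (p589437): same leaves, SEVEN rows at `p₀` — here SIX rows at `p₁`.
WHY `p₁` IS THE NATURAL CURRENCY OF THE REMAINING PROFILE ROWS: (R4)'s top-height clause (`j = K−n−1`, `x = 1`) at `p₁ ≥ p₀ + r₀` is `bound28` verbatim on the new level
(`cB·r(g)·g·p(g) = cB·θ_{b₀,p₀+r₀}`), while the lower heights are print's (27)/(44) content at either profile.  HONEST FRAMING: bookkeeping over hypothesis schemas; nothing of
[Balaban1985UV3]/[King1986] asserted; registry untouched (`--supports stmt-QuantumFields-20520`); the six rows remain DISPLAYS (NODE-O depth); no claim on the stub, the crux,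
d = 4 or the mass gap.

References: C. King, CMP 102 (1986) 649–677 [King1986] (Thm 3.4 (3.9) p.656, Prop. 3.6 (3.56) p.662, Prop. 3.9 (3.71)–(3.74) p.665); T. Bałaban, CMP 102 (1985) 255–275
[Balaban1985UV3] ((7) p.257, (25) p.262, (27)–(28) p.263, (43)–(47) pp.266–267, (57) p.270, (61)–(63) pp.271–272).
-/

set_option autoImplicit false

noncomputable section

open scoped BigOperators
open Finset
open Literature.MathematicalPhysics.QuantumFieldTheory.Balaban1983to89
open Literature.MathematicalPhysics.QuantumFieldTheory.Balaban1983to89.T3ContinuumYM3Torus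
open Literature.MathematicalPhysics.QuantumFieldTheory.Balaban1983to89.T3UnitScaleTilt
open Literature.MathematicalPhysics.QuantumFieldTheory.Balaban1983to89.T3LevelShift
open Literature.MathematicalPhysics.QuantumFieldTheory.Balaban1983to89.T3AlphaInputsAC
open Literature.MathematicalPhysics.QuantumFieldTheory.Balaban1983to89.T3AlphaPolymerSocket
open Literature.MathematicalPhysics.QuantumFieldTheory.Balaban1983to89.T3AlphaInputsACTwoRun
open Literature.MathematicalPhysics.QuantumFieldTheory.Balaban1983to89.T3AlphaInputsACTwoRunLevel
open Literature.MathematicalPhysics.QuantumFieldTheory.Balaban1983to89.B12TreeDecay (kappa₀ K₀ K₀_pos kappa₀_nonneg)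
open Literature.MathematicalPhysics.QuantumFieldTheory.Balaban1985CMP102
open Literature.MathematicalPhysics.QuantumFieldTheory.Balaban1985CMP102.Setting
open Summit.QuantumFields.Balaban3D.Carriers
open Summit.QuantumFields.Balaban3D.Proofs.Primitives
open Summit.QuantumFields.Balaban3D.Proofs.GroupModelLieC (lieC)
open Summit.QuantumFields.Balaban3D.Proofs.NewbornJet (tlConst tlConst_nonneg)
open Summit.QuantumFields.YangMills.Theorems
open Summit.QuantumFields.YangMills.Theorems.GlobalSlack (GlobalSupRateTSlack)
open Summit.QuantumFields.YangMills.Theorems.GlobalSlackKernelMatching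
open Summit.QuantumFields.YangMills.Theorems.GlobalSlackCanonicalPolymers

namespace Summit.QuantumFields.YangMills.Theorems.GlobalSlackKernelLeg

/-! ## §1 The six-row display obligation at a free profile -/

/-- **3⁗χ AS ONE PER-RUN DISPLAY OBLIGATION AT THE LOG-PROFILE `p₁`** (hypothesis schema, never asserted): `K1aLegRowsDisplayChi` (★w1 g0) with the far display (F^Λ) DELETED and the
two configuration rows read at `(𝔠.b₀, p₁)`: a weight rate `κ′ > 0`, a radius `ρ > 0`, nonnegative constants, a threshold `γB`; for every family / coupling a height-free reference
chart family `Ψ` and a coherent reference configuration functional `BR` (BEFORE the (α) hypothesis); for every inhabited χ-package a coherent `p` and ONE `(Φ, e, B)` with (R1)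
`KernelRefOwnΦ`, (R2′) `ChartAnalyticΦ … (rescaleΦw (canonLegDist F) κ′ Φ) 𝔠.κ ρ C_A`, (N) `NewLevelIsBirth`, (M1) `OldTermsAreJetsOwn`, (R4) `CfgDistOwnΦ … 𝔠.b₀ p₁ C_s`,
(R5) `CfgRefOwnΦ … 𝔠.b₀ p₁ a C_B` — each a `∀ K`-statement about ONE run.  Meant at `p₁ ≥ 𝔠.p₀ + 𝔠.r₀` (§2).
[cite: King1986, Thm 3.4 (3.9) p.656, Prop. 3.6 (3.56) p.662, Prop. 3.9 (3.71)-(3.74) p.665; Balaban1985UV3, (25) p.262, (43)-(45) pp.266-267, (57) p.270, (61)-(63) pp.271-272] -/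
def K1aLegRowsDisplayChiAt (L : ℕ) (𝔠 : AlphaConsts L (suGroupModel 2).N) (a₀ a₁ a p₁ : ℝ) : Prop :=
  ∃ (κ' ρ C C_A C_s C_B γB : ℝ), 0 < κ' ∧ 0 < ρ ∧ 0 ≤ C ∧ 0 ≤ C_A ∧ 0 ≤ C_s ∧ 0 ≤ C_B ∧ 0 < γB ∧
    ∀ (F : T3Family) (γ : ℝ) (hF : F.L = L) (hγ : 0 < γ), γ ≤ γB → ∀ (hγ1 : γ ≤ (min (hF ▸ 𝔠).gamma0 1) ^ 2),
      ∃ (Ψ : ChartFam ↥(lieC (suGroupModel 2)) F) (BR : CfgFam ↥(lieC (suGroupModel 2)) F), KerHeightFree Ψ ∧ RefCfgCoherent BR ∧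
        (AlphaInputsT3AC.OfV3ChiAt F (hF ▸ 𝔠) a₀ a₁ →
          ∃ (p : ∀ K, AlphaInputsT3AC.PkgAtV3Chi F (hF ▸ 𝔠) γ hγ hγ1 K), (∀ K, (p K).a₀ = a₀ ∧ (p K).a₁ = a₁) ∧
            ∃ (Φ : ChartFam ↥(lieC (suGroupModel 2)) F) (e : VacFam F) (B : CfgFam ↥(lieC (suGroupModel 2)) F),
              KernelRefOwnΦ (AlphaInputsT3AC.dataOfV3chi p (canonPolymerCore fun K => (p K).toCore)) Φ Ψ (canonLegDist F) κ' (hF ▸ 𝔠).κ a C ∧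
              ChartAnalyticΦ (AlphaInputsT3AC.dataOfV3chi p (canonPolymerCore fun K => (p K).toCore)) (rescaleΦw (canonLegDist F) κ' Φ) (hF ▸ 𝔠).κ ρ C_A ∧
              NewLevelIsBirth (fun K => (p K).toCore) Φ e B ∧
              OldTermsAreJetsOwn (fun K => (p K).toCore) Φ e B ∧
              CfgDistOwnΦ (AlphaInputsT3AC.dataOfV3chi p (canonPolymerCore fun K => (p K).toCore)) B (canonLegDist F) (hF ▸ 𝔠).b₀ p₁ C_s ∧
              CfgRefOwnΦ (AlphaInputsT3AC.dataOfV3chi p (canonPolymerCore fun K => (p K).toCore)) B BR (canonLegDist F) (hF ▸ 𝔠).b₀ p₁ a C_B)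

/-! ## §2 King's slack row at the profile `p₁` from the six rows -/

/-- **THE SIX-ROW DISPLAY AT `p₁ ≥ p₀ + r₀` GIVES KING'S SLACK ROW AT `p₁`** (window AND both summands at `(𝔠.b₀, p₁)`, the currency of ★r1 g5's higher-profile door): for
`0 < a < 1`, `𝔠.p₀ + 𝔠.r₀ ≤ p₁` and `K1aLegRowsDisplayChiAt L 𝔠 a₀ a₁ a p₁` there is a threshold `γB′ > 0` such that every family of block size `L`, every coupling `γ ≤ γB′` in
the record's window and every inhabited χ-package admit a coherent `p`, the canonical polymerisation `π := canonPolymerCore (toCore ∘ p)` and `σ ≥ 7`, `C ≥ 0` with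
`GlobalSupRateTSlack (dataOfV3chi p π) 𝔠.b₀ p₁ a σ C`.  Chain: (R3) at `p₁` is a theorem of (N) ∧ (M1) (`remainderSmallOwnΦ_chi_of_jets_profile`); own → two-run rows
(`kernelRefΦ_of_own` + `flatKernelLegCauchyΦ_of_ref`, `kernelLegΦ_of_chartAnalyticLeg`, `remainderSmallΦ_of_own`, `cfgDistΦ_of_own`, `cfgRefΦ_of_own` + `cfgDistCauchyΦ_of_ref`);
leg → chart currency (`taylorSplitΦ_rescaleW ∘ taylorSplitΦ_residualCore`, `flatKernelCauchyΦ_rescaleW`, `kernelSizeΦ_rescaleW`, `cfgSizeΦ_rescaleW`, `cfgCauchyΦ_rescaleW`);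
producer rows `pintDecompTrivT_canonCore`, `locCover_canonCore`, `locBlockVolumeC_canonCore`, `locMatched_canonCore`, `termSizeTrivT_canonCore_profile`; composition
`globalTwoRunSlackTail_of_chartsC` at `(𝔠.b₀, p₁)`. [cite: King1986, Thm 3.4 (3.9) p.656, Prop. 3.6 (3.56) p.662, Prop. 3.9 (3.71)-(3.74) p.665; Balaban1985UV3, (7) p.257, (24)-(25) p.262, (43)-(47) pp.266-267, (57) p.270, (61)-(63) pp.271-272] -/
theorem globalSupRateTSlack_of_k1aLegRowsDisplayChiAt {L : ℕ} {𝔠 : AlphaConsts L (suGroupModel 2).N} {a₀ a₁ a p₁ : ℝ}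
    (ha : 0 < a) (ha1 : a < 1) (hp : 𝔠.p₀ + 𝔠.r₀ ≤ p₁) (h : K1aLegRowsDisplayChiAt L 𝔠 a₀ a₁ a p₁) :
    ∃ γB : ℝ, 0 < γB ∧ ∀ (F : T3Family) (γ : ℝ) (hF : F.L = L) (hγ : 0 < γ), γ ≤ γB →
      ∀ (hγ1 : γ ≤ (min (hF ▸ 𝔠).gamma0 1) ^ 2),
        AlphaInputsT3AC.OfV3ChiAt F (hF ▸ 𝔠) a₀ a₁ →
          ∃ (p : ∀ K, AlphaInputsT3AC.PkgAtV3Chi F (hF ▸ 𝔠) γ hγ hγ1 K), (∀ K, (p K).a₀ = a₀ ∧ (p K).a₁ = a₁) ∧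
            ∃ (π : AlphaInputsT3AC.PolymerT3 F) (σ : ℕ) (C : ℝ), 7 ≤ σ ∧ 0 ≤ C ∧
              GlobalSupRateTSlack (AlphaInputsT3AC.dataOfV3chi p π) (hF ▸ 𝔠).b₀ p₁ a σ C := by
  obtain ⟨κ', ρ, C, C_A, C_s, C_B, γB, hκ', hρ, hC, hCA, hCs, hCB, hγB, hall⟩ := h
  -- the derived constants of the chart currency
  have hk1 : 0 ≤ 1 + κ'⁻¹ := by positivity
  set C_s' : ℝ := C_s * (1 + κ'⁻¹) with hCs'
  set C_B' : ℝ := 2 * C_B * (1 + κ'⁻¹) with hCB'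
  have hCs'0 : 0 ≤ C_s' := mul_nonneg hCs hk1
  have hCB'0 : 0 ≤ C_B' := mul_nonneg (by linarith) hk1
  have hp₀p₁ : 𝔠.p₀ ≤ p₁ := le_trans (le_add_of_nonneg_right (le_trans zero_le_one 𝔠.one_le_r₀)) hp
  have hp₁ : 0 < p₁ := lt_of_lt_of_le 𝔠.p₀_pos hp₀p₁
  have hm0 : 0 < max 1 (C_s' + C_B') := lt_of_lt_of_le one_pos (le_max_left _ _)
  refine ⟨min γB (min (gammaW L 𝔠 C_s' C_B') (min (gammaθ 𝔠.b₀ p₁ (1 / max 1 (C_s' + C_B'))) (Real.exp (2 * (1 - p₁))))),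
    lt_min hγB (lt_min (gammaW_pos L 𝔠 C_s' C_B') (lt_min (gammaθ_pos 𝔠.b₀_pos hp₁ (by positivity)) (Real.exp_pos _))),
    fun F γ hF hγ hγle hγ1 hOf => ?_⟩
  subst hF
  have hL : 1 ≤ F.L := F.hL.2.le
  have hγ1' : γ ≤ 1 := hγ1.trans (sq_min_one_le _ 𝔠.gamma0_pos)
  have hγB' : γ ≤ γB := hγle.trans (min_le_left _ _)
  have hW : γ ≤ gammaW F.L 𝔠 C_s' C_B' := hγle.trans ((min_le_right _ _).trans (min_le_left _ _))
  have h0 : γ ≤ gammaθ 𝔠.b₀ p₁ (1 / max 1 (C_s' + C_B')) := hγle.trans ((min_le_right _ _).trans ((min_le_right _ _).trans (min_le_left _ _)))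
  have hγe : Real.sqrt γ ≤ Real.exp (1 - p₁) :=
    sqrt_le_exp_of_le (hγle.trans ((min_le_right _ _).trans ((min_le_right _ _).trans (min_le_right _ _))))
  have h1 : γ ≤ gammaθ 𝔠.b₀ (𝔠.p₀ + 𝔠.r₀) (𝔠.ρ / (4 * max 1 𝔠.cB)) := hW.trans ((min_le_right _ _).trans (min_le_left _ _))
  have h2 : γ ≤ gammaθ 𝔠.b₀ 𝔠.p₀ (1 / (2 * (8 * ((F.L : ℝ) + 1) ^ 2 * 𝔠.B₃ * 𝔠.Zfull))) := hW.trans ((min_le_right _ _).trans (min_le_right _ _))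
  -- the display at this family / coupling / package
  obtain ⟨Ψ, BR, hΨ, hBR, himp⟩ := hall F γ rfl hγ hγB' hγ1
  obtain ⟨p, hp', Φ, e, B, hK, hA, hN, hM1, hS, hBC⟩ := himp hOf
  set q : ∀ K, AlphaInputsT3AC.PkgCoreV3 F 𝔠 γ hγ hγ1 K := fun K => (p K).toCore with hq
  obtain ⟨hκ0, hκ₀⟩ := kappa_record_admissible 𝔠
  have hn := canonLegDist_nonneg F
  have hm := canonLegDist_matched F
  -- (R3) at `p₁` is a theorem of (N) ∧ (M1)
  have hCR0 : 0 ≤ (𝔠.Cfar * 𝔠.C25 * tlConst (7 * 𝔠.r₀) 1 + 𝔠.Cfar * 𝔠.C63) * ((Real.sqrt F.L)⁻¹ * (1 + Real.log (Real.sqrt F.L)) ^ p₁) ^ 7 := by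
    have := 𝔠.Cfar_nonneg; have := 𝔠.C25_nonneg; have := 𝔠.C63_nonneg
    have := tlConst_nonneg (q := 7 * 𝔠.r₀) (c := 1) (by linarith [𝔠.one_le_r₀]) one_pos
    have := heightUpFactor_nonneg (F := F) p₁
    positivity
  have hR := remainderSmallOwnΦ_chi_of_jets_profile p hp hN hM1
  -- own → two-run
  have hK2 := flatKernelLegCauchyΦ_of_ref hΨ (kernelRefΦ_canonCore_of_own p hκ0.le hC ha.le hK)
  have hE2 := kernelLegΦ_of_chartAnalyticLeg hA
  have hR2 := remainderSmallΦ_of_own (locMatched_canonCore q) (treeLenRefinedOn_canonCore q) hκ0.le hCR0 hL hγ hγ1' 𝔠.b₀_pos hR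
  have hS2 := cfgDistΦ_of_own (locMatched_canonCore q) hm hS
  have hBC2 := cfgDistCauchyΦ_of_ref hBR (cfgRefΦ_of_own (locMatched_canonCore q) hm hn hL hγ hγ1' 𝔠.b₀_pos hCB ha.le hBC)
  -- leg → chart currency
  have hT3 := taylorSplitΦ_rescaleW (canonLegDist F) κ' (taylorSplitΦ_residualCore q Φ e B)
  have hK3 := flatKernelCauchyΦ_rescaleW hm hK2
  have hE3 := kernelSizeΦ_rescaleW hE2
  have hS3 := cfgSizeΦ_rescaleW hL hγ hγ1' 𝔠.b₀_pos hn hm hκ' hCs hS2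
  have hBC3 := cfgCauchyΦ_rescaleW hL hγ hγ1' 𝔠.b₀_pos hn hm hκ' (by linarith : 0 ≤ 2 * C_B) hBC2
  -- the coupling windows
  have hwin : ∀ n, (C_s' + C_B') * θBal F.L γ 𝔠.b₀ p₁ n ≤ 1 := fun n => window_sum_le_one hL 𝔠.b₀_pos hp₁ hγ hγ1' h0 n
  have hw1 := fun K k hk => window_jet (hγ := hγ) (hγ1 := hγ1) h1 K k hk
  have hw2 := fun K k hk => window_oldSlice (hγ := hγ) (hγ1 := hγ1) h2 K k hk
  have hCT : 0 ≤ max (newConst 𝔠) (oldConst 𝔠 * (F.L : ℝ) ^ 4 * Real.exp (𝔠.κ * (F.L : ℝ) ^ 3)) := le_max_of_le_left (newConst_nonneg 𝔠)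
  have hCE0 : 0 ≤ C_A * (max 1 (12 / ρ)) ^ 6 := by positivity
  obtain ⟨σ, C₀, hσ, hC₀, hG⟩ := globalTwoRunSlackTail_of_chartsC (D := AlphaInputsT3AC.dataOfCoreV3 q (canonPolymerCore q))
    hγ hγ1' hγe 𝔠.b₀_pos hp₁.le ha ha1 (by linarith : 0 ≤ 2 * C) hCE0 hCR0 hCs'0 hCB'0 hCT
    hwin (pintDecompTrivT_canonCore q) (locCover_canonCore q hκ0.le hκ₀) (locBlockVolumeC_canonCore q) (locMatched_canonCore q)
    (termSizeTrivT_canonCore_profile q hκ0 le_rfl hw1 hw2 hp₀p₁) hT3 hK3 hE3 hR2 hS3 hBC3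
  exact ⟨p, hp', canonPolymerCore q, σ, C₀, hσ, hC₀, hG⟩

end Summit.QuantumFields.YangMills.Theorems.GlobalSlackKernelLeg


namespace Summit.QuantumFields.YangMills.Theorems.InteriorExcision

open Literature.MathematicalPhysics.QuantumFieldTheory.Balaban1983to89.T3UnitLawDensityEML (ℰp)
open Literature.MathematicalPhysics.QuantumFieldTheory.Balaban1983to89.T3InteriorExcision
open Literature.MathematicalPhysics.QuantumFieldTheory.Balaban1983to89.T3PrintedRegularMinimiser
open Literature.MathematicalPhysics.QuantumFieldTheory.Balaban1983to89.T3PrintedMinimiserExistence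
open Literature.MathematicalPhysics.QuantumFieldTheory.Balaban1983to89.T3SmallLiftHistory
open Literature.MathematicalPhysics.QuantumFieldTheory.Balaban1983to89.T3LowerAlongMinimisersSplit (MinimisersIn8At)
open Literature.MathematicalPhysics.QuantumFieldTheory.Balaban1983to89.T3ConstrainedMinimiser (fibre)
open Literature.MathematicalPhysics.QuantumFieldTheory.Balaban1983to89.T3Thm1Carrier (famX Idx)
open Literature.MathematicalPhysics.QuantumFieldTheory.Balaban1983to89.T3Thm1CarrierNative (IsCritR2)
open Literature.MathematicalPhysics.QuantumFieldTheory.Balaban1983to89.T3SectALandauChart (ResidFam famLG3 In19 CloseAvg emb15)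
open Literature.MathematicalPhysics.QuantumFieldTheory.Balaban1983to89.B11 (Prop2Printed)
open Summit.QuantumFields.YangMills.Theorems.PrintChi (ChiGood)
open Summit.QuantumFields.YangMills.Theorems.Prop7TPrint (nMax19 expHermField)
open Summit.QuantumFields.YangMills.Theorems.Prop7SPrint (sPrint RestrictedPrint AvgCondPrint IsLandauPrint CritLPrint)
open Summit.QuantumFields.YangMills.Theorems.GlobalSlackKernelLeg (K1aLegRowsDisplayChiAt globalSupRateTSlack_of_k1aLegRowsDisplayChiAt)

/-! ## §3 The deciding crux through the higher-profile door, fed by the six-row display -/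

/-- **THE DECIDING CRUX FROM T8, THE χ-RECORD AND THE SIX-ROW DISPLAY AT A SUPPLIER-CHOSEN PROFILE `p₁ ≥ p₀ + r₀`, EVERY ODD BLOCK SIZE**: T8's text, 2′χ, and — for every odd
`L > 1`, every record and [7]-constants — a rate `a ∈ (0,1)`, a profile `p₁` with `𝔠.p₀ + 𝔠.r₀ ≤ p₁` and `K1aLegRowsDisplayChiAt L 𝔠 a₀ a₁ a p₁`, give `FluctuationComparisonRegPrIntL`:
STUB 1 is the theorem `ApproxLift.AnsatzT.stub_oneStepSmallLift`; the slack row at `(𝔠.b₀, p₁)` is §2 (full window), restricted to print's `χ` by `GlobalSlackOn.on_of_global`; then ★r1 g5's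
door `regPrIntL_of_recChi_slackOnChi_higherProfile_allL` (the `p₀`-window data are `p₁`-window data; the S-E″ radii at `p₁`).  (F^Λ) is NOT among the hypotheses.
[cite: King1986, Thm 3.4 (3.9) p.656, (3.42) p.660; Balaban1985UV3, (41) p.266, (43)-(47) pp.266-267, (57) p.270, (61)-(63) pp.271-272, Thm 2 p.272; Balaban1985Variational, Thm 1 (8) p.279; Balaban1987RG1, (0.4) p.253] -/
theorem regPrIntL_of_T8_recChi_k1aLegRowsDisplayChiAt_allL
    (hT8 : ∀ L : ℕ, Odd L → 1 < L → ∃ a₀ a₁ B₃ : ℝ, 0 < a₀ ∧ 0 < a₁ ∧ 0 < B₃ ∧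
      Thm1GlobalMinAt L a₀ a₁ B₃ ∧ MinimisersIn8At L a₀ a₁ B₃)
    (h2 : ∀ L : ℕ, Odd L → 1 < L → Summit.QuantumFields.YangMills.Theorems.AlphaInputsT3ACv3RecChi L)
    (hDisp : ∀ (L : ℕ), Odd L → 1 < L → ∀ (𝔠 : AlphaConsts L (suGroupModel 2).N) (a₀ a₁ : ℝ), 0 < a₀ → 0 < a₁ → 𝔠.B₃ * a₁ ≤ a₀ →
      ∃ a : ℝ, 0 < a ∧ a < 1 ∧ ∃ p₁ : ℝ, 𝔠.p₀ + 𝔠.r₀ ≤ p₁ ∧ K1aLegRowsDisplayChiAt L 𝔠 a₀ a₁ a p₁) :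
    FluctuationComparisonRegPrIntL := by
  refine regPrIntL_of_recChi_slackOnChi_higherProfile_allL Summit.QuantumFields.YangMills.Theorems.ApproxLift.AnsatzT.stub_oneStepSmallLift hT8 h2
    fun L hLo hL μ _ _ 𝔠 a₀ a₁ ha0 ha1 hw => ?_
  obtain ⟨a, ha, ha1, p₁, hp₁, hD⟩ := hDisp L hLo hL 𝔠 a₀ a₁ ha0 ha1 hw
  obtain ⟨γB, hγB, hall⟩ := globalSupRateTSlack_of_k1aLegRowsDisplayChiAt ha ha1 hp₁ hD
  have hp₀p₁ : 𝔠.p₀ ≤ p₁ := le_trans (le_add_of_nonneg_right (le_trans zero_le_one 𝔠.one_le_r₀)) hp₁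
  refine ⟨a, ha, ha1, p₁, hp₀p₁, γB, hγB, fun F γ hF hγ hγle hγ1 hOf => ?_⟩
  obtain ⟨p, hp, π, σ, C, hσ, hC, hG⟩ := hall F γ hF hγ hγle hγ1 hOf
  exact ⟨p, hp, π, σ, C, hσ, hC, fun ε₀ _ _ => GlobalSlackOn.on_of_global _ _ hG⟩

/-- **THE DECIDING CRUX FROM 19200's FIVE v8 LEAVES, THE χ-RECORD AND THE SIX-ROW DISPLAY AT `p₁ ≥ p₀ + r₀`, EVERY ODD BLOCK SIZE**: V2′ (`stub_halvingStep`), P-V3-A/C/D/E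
(`stub_PV3A`, `stub_PV3C`, `stub_PV3D`, `stub_PV3E`) VERBATIM, 2′χ, and the six-row display at a supplier-chosen profile give `FluctuationComparisonRegPrIntL`
(`regPrIntL_of_T8_recChi_k1aLegRowsDisplayChiAt_allL ∘ thm1In8GlobalMin_of_v8Leaves`).  The `p₀`-currency twin with SEVEN rows is ★r1 g5's
`regPrIntL_of_v8Leaves_recChi_k1aLegRowsDisplayChi_allL`. [cite: Balaban1985UV3, (41) p.266, (43)-(47) pp.266-267, (57) p.270, (61)-(63) pp.271-272, Thm 2 p.272; Balaban1985Variational, Thm 1 (8) p.279, Prop. 2 p.281, Props 5-6 pp.294-296, Prop. 7 p.299, (141)-(142) p.299, Prop. 8 p.304; King1986, Thm 3.4 (3.9) p.656, Prop. 3.6 (3.56) p.662, Prop. 3.9 (3.71)-(3.74) p.665] -/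
theorem regPrIntL_of_v8Leaves_recChi_k1aLegRowsDisplayChiAt_allL
    (hV2 : ∀ (L : ℕ), 1 < L → ∃ B₃ : ℝ, 4 < B₃ ∧ ∃ a₅ : ℝ, 0 < a₅ ∧
      ∀ (i : Idx L) (ε₀ ε₁ : ℝ), 0 < ε₁ → ∀ (V : (famX L i).Bdry) (U : (famX L i).Cfg), (famX L i).Reg7 ε₁ V → (famX L i).InU ε₀ U →
        (famX L i).InB V U → (famX L i).IsCritical V U → ε₀ ≤ a₅ → (famX L i).InU (max (B₃ * ε₁) (ε₀ / 2)) U)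
    (hA : ∀ (L : ℕ), 1 < L → ∀ (T : ResidFam L) (B₃ : ℝ), 4 < B₃ →
      ∃ B₁ c₁ : ℝ, 0 < B₁ ∧ 0 < c₁ ∧ Prop2Printed B₁ B₃ ((L : ℝ) ^ 3) c₁ (famLG3 L (sPrint L T)))
    (hC : ∀ (L : ℕ), 1 < L → ∀ (B₃ : ℝ), 4 < B₃ →
      ∃ B₀ a₄ : ℝ, 0 < B₀ ∧ 0 < a₄ ∧ ∀ (i : Idx L) (ε₁ ε₄ : ℝ), 0 < ε₁ → ε₄ ≤ a₄ → 2 * B₀ * (L : ℝ) ^ 3 * B₃ * ε₁ ≤ ε₄ →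
        ∀ (V : GaugeField (i.1.1.P i.1.2.1) 0 (Matrix.specialUnitaryGroup (Fin 2) ℂ))
          (U₀ : GaugeField (i.1.1.P i.1.2.2) 0 (Matrix.specialUnitaryGroup (Fin 2) ℂ)),
          RegPr i.1.1 i.1.2.1 i.1.2.2 ((L : ℝ) ^ 3 * B₃ * ε₁) U₀ → CloseAvg i.1.1 i.1.2.1 i.1.2.2 i.2.2.le ((L : ℝ) ^ 3 * ε₁) V U₀ →
          ∃ X : PBond (i.1.1.P i.1.2.2) 0 → Matrix (Fin 2) (Fin 2) ℂ,
            nMax19 i.1.1 i.1.2.1 i.1.2.2 U₀ X < ε₄ ∧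
            ((∀ b : PBond (i.1.1.P i.1.2.2) 0, (X b).IsHermitian ∧ Matrix.trace (X b) = 0) ∧ AvgCondPrint i.1.1 i.1.2.1 i.1.2.2 i.2.2.le V U₀ X ∧
              IsLandauPrint i.1.1 i.1.2.1 i.1.2.2 U₀ X ∧ CritLPrint i.1.1 i.1.2.1 i.1.2.2 i.2.2.le V U₀ (expHermField X)) ∧
            nMax19 i.1.1 i.1.2.1 i.1.2.2 U₀ X < 3 * B₀ * (L : ℝ) ^ 3 * B₃ * ε₁ ∧
            ∀ X' : PBond (i.1.1.P i.1.2.2) 0 → Matrix (Fin 2) (Fin 2) ℂ, nMax19 i.1.1 i.1.2.1 i.1.2.2 U₀ X' < ε₄ →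
              ((∀ b : PBond (i.1.1.P i.1.2.2) 0, (X' b).IsHermitian ∧ Matrix.trace (X' b) = 0) ∧ AvgCondPrint i.1.1 i.1.2.1 i.1.2.2 i.2.2.le V U₀ X' ∧
                IsLandauPrint i.1.1 i.1.2.1 i.1.2.2 U₀ X' ∧ CritLPrint i.1.1 i.1.2.1 i.1.2.2 i.2.2.le V U₀ (expHermField X')) → X' = X)
    (hD : ∀ (L : ℕ), 1 < L → ∀ (B₃ : ℝ), 4 < B₃ →
      ∃ O₂ c : ℝ, 1 ≤ O₂ ∧ 0 < c ∧ ∀ (i : Idx L) (ε₁ ε₂ : ℝ) (V : GaugeField (i.1.1.P i.1.2.1) 0 (Matrix.specialUnitaryGroup (Fin 2) ℂ))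
        (U₀ U₁ : GaugeField (i.1.1.P i.1.2.2) 0 (Matrix.specialUnitaryGroup (Fin 2) ℂ)) (X : PBond (i.1.1.P i.1.2.2) 0 → Matrix (Fin 2) (Fin 2) ℂ),
        (L : ℝ) ^ 3 * B₃ * ε₁ ≤ ε₂ → ε₂ ≤ c → RegPr i.1.1 i.1.2.1 i.1.2.2 ((L : ℝ) ^ 3 * B₃ * ε₁) U₀ → CloseAvg i.1.1 i.1.2.1 i.1.2.2 i.2.2.le ((L : ℝ) ^ 3 * ε₁) V U₀ →
        In19 i.1.1 i.1.2.1 i.1.2.2 ε₂ U₀ U₁ X → AvgCondPrint i.1.1 i.1.2.1 i.1.2.2 i.2.2.le V U₀ X → IsLandauPrint i.1.1 i.1.2.1 i.1.2.2 U₀ X →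
        CritLPrint i.1.1 i.1.2.1 i.1.2.2 i.2.2.le V U₀ U₁ →
          ∃ u : GaugeTransf (i.1.1.P i.1.2.2) 0 (Matrix.specialUnitaryGroup (Fin 2) ℂ), RestrictedPrint i.1.1 i.1.2.1 i.1.2.2 U₀ u ∧
            RegPr i.1.1 i.1.2.1 i.1.2.2 (O₂ * ε₂) (GaugeField.gaugeAct u (emb15 U₀ U₁)) ∧
            GaugeField.gaugeAct u (emb15 U₀ U₁) ∈ fibre i.1.1 ℰp i.1.2.1 i.1.2.2 i.2.2.le V ∧
            IsCritR2 i.1.1 i.1.2.1 i.1.2.2 i.2.2.le V (GaugeField.gaugeAct u (emb15 U₀ U₁)))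
    (hE : ∀ (L : ℕ), 1 < L → ∀ (B₃ : ℝ), 4 < B₃ →
      ∃ e₅ : ℝ, 0 < e₅ ∧ ∀ (i : Idx L) (e ε₁ : ℝ) (V : GaugeField (i.1.1.P i.1.2.1) 0 (Matrix.specialUnitaryGroup (Fin 2) ℂ))
        (U₀ U₁ : GaugeField (i.1.1.P i.1.2.2) 0 (Matrix.specialUnitaryGroup (Fin 2) ℂ)) (u : GaugeTransf (i.1.1.P i.1.2.2) 0 (Matrix.specialUnitaryGroup (Fin 2) ℂ)),
        e ≤ e₅ → RegPr i.1.1 i.1.2.1 i.1.2.2 ((L : ℝ) ^ 3 * B₃ * ε₁) U₀ → CloseAvg i.1.1 i.1.2.1 i.1.2.2 i.2.2.le ((L : ℝ) ^ 3 * ε₁) V U₀ →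
        CritLPrint i.1.1 i.1.2.1 i.1.2.2 i.2.2.le V U₀ U₁ → RestrictedPrint i.1.1 i.1.2.1 i.1.2.2 U₀ u →
        RegPr i.1.1 i.1.2.1 i.1.2.2 e (GaugeField.gaugeAct u (emb15 U₀ U₁)) →
        GaugeField.gaugeAct u (emb15 U₀ U₁) ∈ fibre i.1.1 ℰp i.1.2.1 i.1.2.2 i.2.2.le V →
        IsCritR2 i.1.1 i.1.2.1 i.1.2.2 i.2.2.le V (GaugeField.gaugeAct u (emb15 U₀ U₁)) →
          GaugeField.gaugeAct u (emb15 U₀ U₁) ∈ regFibrePr i.1.1 i.1.2.1 i.1.2.2 i.2.2.le e V ∧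
          IsMinOn (fun W : GaugeField (i.1.1.P i.1.2.2) 0 (Matrix.specialUnitaryGroup (Fin 2) ℂ) => wilsonAction4 W)
            (regFibrePr i.1.1 i.1.2.1 i.1.2.2 i.2.2.le e V) (GaugeField.gaugeAct u (emb15 U₀ U₁)))
    (h2 : ∀ L : ℕ, Odd L → 1 < L → Summit.QuantumFields.YangMills.Theorems.AlphaInputsT3ACv3RecChi L)
    (hDisp : ∀ (L : ℕ), Odd L → 1 < L → ∀ (𝔠 : AlphaConsts L (suGroupModel 2).N) (a₀ a₁ : ℝ), 0 < a₀ → 0 < a₁ → 𝔠.B₃ * a₁ ≤ a₀ →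
      ∃ a : ℝ, 0 < a ∧ a < 1 ∧ ∃ p₁ : ℝ, 𝔠.p₀ + 𝔠.r₀ ≤ p₁ ∧ K1aLegRowsDisplayChiAt L 𝔠 a₀ a₁ a p₁) :
    FluctuationComparisonRegPrIntL :=
  regPrIntL_of_T8_recChi_k1aLegRowsDisplayChiAt_allL (thm1In8GlobalMin_of_v8Leaves hV2 hA hC hD hE) h2 hDisp

end Summit.QuantumFields.YangMills.Theorems.InteriorExcision

end
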